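import Summits.AnomalousDissipation.AnomalousDissipation.Theorems.SawtoothPulseCascadeK1LocalisedCascadeCanonicalRatioStepsOsc
import Summits.AnomalousDissipation.AnomalousDissipation.Theorems.SawtoothPulseCascadeK1LocalisedCascadeCanonicalBlocksMax

/-!
# K1loc — THE FLAT SHELL (A′-V) AND ITS SHALLOW FEED (B′-H) AT ARBITRARY THRESHOLDS, OSCILLATORY GRADE (thin-tail cap, canonical blocks)

Prover lane on the crux `K1LocalisedCascade` (stmt-AnomalousDissipation-19491), route `SawtoothPulseCascade`
(S-B/S-C assembly seat; the LEDGER ASSEMBLY, thin tail).  In the thin phases the (C-H) window feeding the strip/off-cone classes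
(`…ThinRatioStepsOsc.ratioClass_hstep_thinOsc_le`, class `16|k₁| ≤ 125|k₀|`) takes its own feed from the FLAT shell
`A′(X) = Σ'[X ≤ |k₀| ∧ 2|k₀| ≤ 15|k₁|]‖𝓕a‖²` (slopes `≥ 2/15`, just above the cascade's cone `≤ 0.127`), not from the shell
`|k₀| ≤ 2|k₁|` of the fat phases.  The flat shell is capped in two canonical-block steps (doubling blocks, `max` cut-offs of
`…CanonicalBlocksMax`) and then by the EXISTING fat shell chain (`…ShellChainOsc`) at the lower threshold `Y′`:
* (A′-V) `flatShell_vstep_osc_le`: class `(2,15)` at `X ≥ 1500`, fibre floor `Λ₀ = ⌊2X/15⌋`, margin `2/5`, slope `1/3`, feed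
  `B′(Y′) = Σ'[Y′ ≤ |k₀| ∧ |k₁| ≤ 6|k₀|]‖𝓕b_i‖²` for any `Y′` with `3(Y′ − 1) ≤ Λ₀`; `r* = 12`, `A* = 159`, `D₀ = Λ₀/10`;
* (B′-H) `flatShallow_hstep_osc_le`: class `(1,6)` of `b_i` at `Y′ ≥ 50` (fibre floor `Y′`), margin `19/10`, slope `1`, feed = the fat shell
  `A(Y′) = Σ'[Y′ ≤ |k₀| ∧ |k₀| ≤ 2|k₁|]‖𝓕a_i‖²`; `r* = 10/3`, `A* = 159`, `D₀ = Y′/10`.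
Junk shapes as in `…PhaseABOsc` (`J = 3r*²((4/3)ε² + (4/3)(2·2^i/(πD₀))² + 8·2^iA*/(πD₀) + (7i+20)(8·2^iA*²√(4Mδ_i/(πD₀)) + 8A*²Mδ_i/π))`,
rounding targets `η = (ε/(159·8π·2^20·Λ₀))·64^{−i}`); they are certified by `…OscJunkNumeric.sqrt_oscJunk_le_of_cert`.
No definitions; no statement about the crux. [cite: Grafakos2014, Prop. 3.1.2 (5), Prop. 3.2.7 (3), §3.1.3] [problem: turb]
-/

-- `Summit.<Summit>.<Problem>`: single-conjunct summit, the duplicate namespace segment is deliberate.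
set_option linter.dupNamespace false

noncomputable section

namespace Summit.AnomalousDissipation.AnomalousDissipation.Theorems.SawtoothPulseCascade.K1Window

open MeasureTheory Set Filter Topology UnitAddTorus Function Complex Metric
open scoped Real ENNReal
open Literature.Analysis Literature.Analysis.FunctionSpaces Literature.Analysis.FunctionSpaces.Torus Literature.Analysis.FluidPDE
open Literature.Analysis.FluidPDE.ShearStage
open Literature.Analysis.FluidPDE.SawtoothCascade Literature.Analysis.FluidPDE.SawtoothCascade.CascadeParams
open Summit.AnomalousDissipation.AnomalousDissipation.Theorems.SawtoothPulseCascade.K1Start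
open Summit.AnomalousDissipation.AnomalousDissipation.Theorems.SawtoothPulseCascade.K1Flat
open Summit.AnomalousDissipation.AnomalousDissipation.Theorems.SawtoothPulseCascade.K1Ledger.From

/-- **The cut-off ratio of the (A′-V) blocks** (max family, `t = 1/3`, `β = 2/5`, `Λ₀ ≥ 195`): `r_m ≤ 12`. [folklore] -/
theorem flatShell_cutoff_le {Λ0 Y₀ : ℕ} (hΛ0 : 195 ≤ Λ0) (hY₀ : Y₀ * 3 ≤ 1 * Λ0) (m : ℕ) :
    (((max (2 * 1 * (Λ0 * 2 ^ m) / 6) Y₀ : ℕ) : ℝ) + ((2 * (Λ0 * 2 ^ m) / 5 : ℕ) : ℝ)) /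
        (((2 * (Λ0 * 2 ^ m) / 5 : ℕ) : ℝ) - ((max (2 * 1 * (Λ0 * 2 ^ m) / 6) Y₀ : ℕ) : ℝ)) ≤ 12 := by
  have h1 : 2 * 1 * 3 ≤ 1 * 6 := by norm_num
  have h3 : 1 * 5 * Λ0 + 2 * 5 * 3 ≤ 2 * 3 * Λ0 := by omega
  have hr := canonMax_r_le (u' := 1) (v' := 6) (Y₀ := Y₀) (tn := 1) (td := 3) (qn := 2) (qd := 5) (Λ0 := Λ0)
    (by norm_num) (by norm_num) (by norm_num) h1 hY₀ h3 m
  have hΛ0r : (195 : ℝ) ≤ Λ0 := by exact_mod_cast hΛ0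
  have hden : (0 : ℝ) < (((2 : ℕ) : ℝ) / ((5 : ℕ) : ℝ) - ((1 : ℕ) : ℝ) / ((3 : ℕ) : ℝ)) * (Λ0 : ℝ) - 1 := by
    push_cast; linarith
  have hrs : ((((1 : ℕ) : ℝ) / ((3 : ℕ) : ℝ) + ((2 : ℕ) : ℝ) / ((5 : ℕ) : ℝ)) * (Λ0 : ℝ) + 1) /
      ((((2 : ℕ) : ℝ) / ((5 : ℕ) : ℝ) - ((1 : ℕ) : ℝ) / ((3 : ℕ) : ℝ)) * (Λ0 : ℝ) - 1) ≤ 12 := by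
    rw [div_le_iff₀ hden]
    push_cast; linarith
  exact hr.trans hrs

/-- **The cut-off ratio of the (B′-H) blocks** (max family, `t = 1`, `β = 19/10`, `Λ₀ ≥ 50`, `Y₀ ≤ Λ₀`): `r_m ≤ 10/3`. [folklore] -/
theorem flatShallow_cutoff_le {Y Y₀ : ℕ} (hY : 50 ≤ Y) (hY₀ : Y₀ * 1 ≤ 1 * Y) (m : ℕ) :
    (((max (2 * 1 * (Y * 2 ^ m) / 2) Y₀ : ℕ) : ℝ) + ((19 * (Y * 2 ^ m) / 10 : ℕ) : ℝ)) /
        (((19 * (Y * 2 ^ m) / 10 : ℕ) : ℝ) - ((max (2 * 1 * (Y * 2 ^ m) / 2) Y₀ : ℕ) : ℝ)) ≤ 10 / 3 := by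
  have h1 : 2 * 1 * 1 ≤ 1 * 2 := by norm_num
  have h3 : 1 * 10 * Y + 2 * 10 * 1 ≤ 19 * 1 * Y := by omega
  have hr := canonMax_r_le (u' := 1) (v' := 2) (Y₀ := Y₀) (tn := 1) (td := 1) (qn := 19) (qd := 10) (Λ0 := Y)
    (by norm_num) (by norm_num) (by norm_num) h1 hY₀ h3 m
  have hYr : (50 : ℝ) ≤ Y := by exact_mod_cast hY
  have hden : (0 : ℝ) < (((19 : ℕ) : ℝ) / ((10 : ℕ) : ℝ) - ((1 : ℕ) : ℝ) / ((1 : ℕ) : ℝ)) * (Y : ℝ) - 1 := by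
    push_cast; linarith
  have hrs : ((((1 : ℕ) : ℝ) / ((1 : ℕ) : ℝ) + ((19 : ℕ) : ℝ) / ((10 : ℕ) : ℝ)) * (Y : ℝ) + 1) /
      ((((19 : ℕ) : ℝ) / ((10 : ℕ) : ℝ) - ((1 : ℕ) : ℝ) / ((1 : ℕ) : ℝ)) * (Y : ℝ) - 1) ≤ 10 / 3 := by
    rw [div_le_iff₀ hden]
    push_cast; linarith
  exact hr.trans hrs

section Cascade

variable (P : CascadeParams)

set_option maxHeartbeats 400000 in
/-- **(A′-V) THE FLAT SHELL AT THRESHOLD `X ≥ 1500`, PHASE `i`, OSCILLATORY GRADE** (see the file header): feed `B′(Y′)` for any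
`Y′` with `3(Y′ − 1) ≤ ⌊2X/15⌋`. [cite: Grafakos2014, Prop. 3.1.2 (5), Prop. 3.2.7 (3), §3.1.3] -/
theorem flatShell_vstep_osc_le (hγ : P.γ = 8) (hδ₀ : 0 < P.δ₀) (hd : P.d = 2) (hN₀ : P.N₀ = 1) (hρN : P.ρN = 2)
    (a b : ℕ → UnitAddTorus (Fin 2) → ℝ) (has : ∀ j, IsSmooth (a j)) (h0 : a 0 = datum)
    (hb : ∀ j, b j = a j ∘ shearMap 0 1 (amp ⟨P.U j, P.U_periodic j, P.contDiff_U (P.δ_pos hδ₀ (by rw [hd]; norm_num) j)⟩ P.γ))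
    (hab : ∀ j, a (j + 1) = b j ∘ shearMap 1 0 (amp ⟨P.U j, P.U_periodic j, P.contDiff_U (P.δ_pos hδ₀ (by rw [hd]; norm_num) j)⟩ P.γ))
    {X Y' : ℕ} (hX : 1500 ≤ X) (hY' : (Y' - 1) * 3 ≤ 1 * (2 * X / 15)) {ε : ℝ} (hε : 0 < ε) (i : ℕ)
    (hMδ : max 1 (Real.sqrt (2 * Real.log (1 / (ε / (159 * π * 8 * 2 ^ 20 * ((2 * X / 15 : ℕ) : ℝ)) * (1 / 64) ^ i)))) * P.δ i
      < π / 2) :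
    ∑' k : Fin 2 → ℤ, (if (X : ℤ) ≤ |k 0| ∧ ((2 : ℕ) : ℤ) * |k 0| ≤ ((15 : ℕ) : ℤ) * |k 1| then (1 : ℝ) else 0) *
        ‖mFourierCoeff (fun x => (a (i + 1) x : ℂ)) k‖ ^ 2 ≤
      (Real.sqrt (3 * 12 ^ 2 *
            (4 / 3 * ε ^ 2 + 4 / 3 * (2 * 2 ^ i / (π * (((2 * X / 15 : ℕ) : ℝ) / 10))) ^ 2 + 8 * 2 ^ i * 159 / (π * (((2 * X / 15 : ℕ) : ℝ) / 10)) +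
              ((7 * i + 20 : ℕ) : ℝ) * (8 * 2 ^ i * 159 ^ 2 *
                Real.sqrt (4 * (max 1 (Real.sqrt (2 * Real.log (1 / (ε / (159 * π * 8 * 2 ^ 20 * ((2 * X / 15 : ℕ) : ℝ)) * (1 / 64) ^ i)))) * P.δ i) /
                  (π * (((2 * X / 15 : ℕ) : ℝ) / 10))) +
                8 * 159 ^ 2 * (max 1 (Real.sqrt (2 * Real.log (1 / (ε / (159 * π * 8 * 2 ^ 20 * ((2 * X / 15 : ℕ) : ℝ)) * (1 / 64) ^ i)))) * P.δ i) / π))) +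
          Real.sqrt (∑' k : Fin 2 → ℤ, (if (Y' : ℤ) ≤ |k 0| ∧ ((1 : ℕ) : ℤ) * |k 1| ≤ ((6 : ℕ) : ℤ) * |k 0| then (1 : ℝ) else 0) *
            ‖mFourierCoeff (fun x => (b i x : ℂ)) k‖ ^ 2)) ^ 2 +
        ((1 + P.γ) ^ (2 * (i + 1)) / (((2 * X / 15) * 2 ^ (7 * i + 20) : ℕ) : ℝ)) ^ 2 := by
  have hΛ06 : 195 ≤ 2 * X / 15 := by omega
  have hΛ01 : 1 ≤ 2 * X / 15 := le_trans (by norm_num) hΛ06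
  have hΛ0r : (195 : ℝ) ≤ ((2 * X / 15 : ℕ) : ℝ) := by exact_mod_cast hΛ06
  have hΛ0pos : (0 : ℝ) < ((2 * X / 15 : ℕ) : ℝ) := by linarith
  have hγ' : P.γ = ((8 : ℕ) : ℝ) := by rw [hγ]; norm_num
  have hd' : 0 < P.d := by rw [hd]; norm_num
  have hN₀' : 1 ≤ P.N₀ := by rw [hN₀]
  have hρN' : 1 ≤ P.ρN := by rw [hρN]; norm_num
  have hNi : (P.N i : ℝ) = 2 ^ i := by rw [CascadeParams.N, hN₀, hρN]; push_cast; ring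
  have hΛX : 15 * (2 * X / 15) ≤ 2 * X := Nat.mul_div_le (2 * X) 15
  have h1 : 2 * 1 * 3 ≤ 1 * 6 := by norm_num
  have h3 : 1 * 5 * (2 * X / 15) + 2 * 5 * 3 ≤ 2 * 3 * (2 * X / 15) := by omega
  set η : ℝ := (ε / (159 * π * 8 * 2 ^ 20 * ((2 * X / 15 : ℕ) : ℝ)) * (1 / 64) ^ i) with hη
  have hπ := Real.pi_pos
  have hηpos : 0 < η := by rw [hη]; positivity
  have hstep := ratioClass_vstep_canonicalOsc_le P hγ' hδ₀ hd' hN₀' hρN' a b has h0 hb hab i (u := 2) (v := 15) (X := X)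
    (u' := 1) (v' := 6) (Y := Y') (qn := 2) (qd := 5) (Λ0 := 2 * X / 15) (by norm_num) (by norm_num) (by norm_num) (by norm_num)
    (by norm_num) hΛ01 hΛX (fun m => max (2 * 1 * ((2 * X / 15) * 2 ^ m) / 6) (Y' - 1))
    (fun m => canonMax_Q₁_lt_Q₂ (by norm_num) (by norm_num) (by norm_num) h1 hY' h3 m)
    (fun m => canonMax_feed (by norm_num) (Y' - 1) (2 * X / 15) m) (rs := 12) (fun m => flatShell_cutoff_le hΛ06 hY' m)
    (fun m => le_trans (by omega) (canonMax_Y 1 6 (Y' - 1) (2 * X / 15) m)) (7 * i + 20) hηpos hMδ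
  -- the exact constants at `(u,v,q_n,q_d) = (2,15,2,5)`: `A* = 159`, `D₀ = Λ₀/10`
  have eratio : ((((15 : ℕ) : ℝ) + ((2 : ℕ) : ℝ) * ((8 : ℕ) : ℝ)) * ((5 : ℕ) : ℝ) + ((2 : ℕ) : ℝ) * ((2 : ℕ) : ℝ)) /
      ((((2 : ℕ) : ℝ) * ((8 : ℕ) : ℝ) - ((15 : ℕ) : ℝ)) * ((5 : ℕ) : ℝ) - ((2 : ℕ) : ℝ) * ((2 : ℕ) : ℝ)) = 159 := by
    push_cast; norm_num
  have eD : ((((2 : ℕ) : ℝ) * ((8 : ℕ) : ℝ) - ((15 : ℕ) : ℝ)) * ((5 : ℕ) : ℝ) - ((2 : ℕ) : ℝ) * ((2 : ℕ) : ℝ)) * ((2 * X / 15 : ℕ) : ℝ) /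
      (((2 : ℕ) : ℝ) * ((5 : ℕ) : ℝ)) = ((2 * X / 15 : ℕ) : ℝ) / 10 := by
    push_cast; ring
  refine le_sq_sqrt_add_mono hstep ?_
  rw [eratio, eD, hNi]
  have hXe : (159 : ℝ) * π * ((8 : ℕ) : ℝ) * η * ((2 * X / 15 : ℕ) : ℝ) / 2 ^ i * 2 ^ (7 * i + 20) = ε := by
    have e2 : (2 : ℝ) ^ (7 * i + 20) = 2 ^ 20 * 128 ^ i := by
      rw [pow_add, pow_mul]; norm_num; ring
    have p1 : ((1 : ℝ) / 64) ^ i * (128 : ℝ) ^ i = (2 : ℝ) ^ i := by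
      rw [← mul_pow]; norm_num
    have hne1 : (159 : ℝ) * Real.pi * 8 * 2 ^ 20 * ((2 * X / 15 : ℕ) : ℝ) ≠ 0 := by positivity
    have hne2 : (2 : ℝ) ^ i ≠ 0 := pow_ne_zero _ two_ne_zero
    rw [hη, e2]
    push_cast
    calc (159 : ℝ) * π * 8 * (ε / (159 * π * 8 * 2 ^ 20 * ((2 * X / 15 : ℕ) : ℝ)) * (1 / 64) ^ i) * ((2 * X / 15 : ℕ) : ℝ) / 2 ^ i *
          (2 ^ 20 * 128 ^ i)
        = ε * (((159 : ℝ) * Real.pi * 8 * 2 ^ 20 * ((2 * X / 15 : ℕ) : ℝ)) / (159 * Real.pi * 8 * 2 ^ 20 * ((2 * X / 15 : ℕ) : ℝ))) *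
            ((((1 : ℝ) / 64) ^ i * 128 ^ i) / 2 ^ i) := by
          field_simp
      _ = ε := by rw [p1, div_self hne1, div_self hne2]; ring
  rw [hXe]

set_option maxHeartbeats 400000 in
/-- **(B′-H) THE SHALLOW FEED OF THE FLAT SHELL AT THRESHOLD `Y′ ≥ 50`, PHASE `i`, OSCILLATORY GRADE** (see the file header): feed =
the fat shell `A(Y′)`. [cite: Grafakos2014, Prop. 3.1.2 (5), Prop. 3.2.7 (3), §3.1.3] -/
theorem flatShallow_hstep_osc_le (hγ : P.γ = 8) (hδ₀ : 0 < P.δ₀) (hd : P.d = 2) (hN₀ : P.N₀ = 1) (hρN : P.ρN = 2)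
    (a b : ℕ → UnitAddTorus (Fin 2) → ℝ) (has : ∀ j, IsSmooth (a j)) (h0 : a 0 = datum)
    (hb : ∀ j, b j = a j ∘ shearMap 0 1 (amp ⟨P.U j, P.U_periodic j, P.contDiff_U (P.δ_pos hδ₀ (by rw [hd]; norm_num) j)⟩ P.γ))
    (hab : ∀ j, a (j + 1) = b j ∘ shearMap 1 0 (amp ⟨P.U j, P.U_periodic j, P.contDiff_U (P.δ_pos hδ₀ (by rw [hd]; norm_num) j)⟩ P.γ))
    {Y : ℕ} (hY : 50 ≤ Y) {ε : ℝ} (hε : 0 < ε) (i : ℕ)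
    (hMδ : max 1 (Real.sqrt (2 * Real.log (1 / (ε / (159 * π * 8 * 2 ^ 20 * (Y : ℝ)) * (1 / 64) ^ i)))) * P.δ i < π / 2) :
    ∑' k : Fin 2 → ℤ, (if (Y : ℤ) ≤ |k 0| ∧ ((1 : ℕ) : ℤ) * |k 1| ≤ ((6 : ℕ) : ℤ) * |k 0| then (1 : ℝ) else 0) *
        ‖mFourierCoeff (fun x => (b i x : ℂ)) k‖ ^ 2 ≤
      (Real.sqrt (3 * (10 / 3) ^ 2 *
            (4 / 3 * ε ^ 2 + 4 / 3 * (2 * 2 ^ i / (π * ((Y : ℝ) / 10))) ^ 2 + 8 * 2 ^ i * 159 / (π * ((Y : ℝ) / 10)) +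
              ((7 * i + 20 : ℕ) : ℝ) * (8 * 2 ^ i * 159 ^ 2 *
                Real.sqrt (4 * (max 1 (Real.sqrt (2 * Real.log (1 / (ε / (159 * π * 8 * 2 ^ 20 * (Y : ℝ)) * (1 / 64) ^ i)))) * P.δ i) / (π * ((Y : ℝ) / 10))) +
                8 * 159 ^ 2 * (max 1 (Real.sqrt (2 * Real.log (1 / (ε / (159 * π * 8 * 2 ^ 20 * (Y : ℝ)) * (1 / 64) ^ i)))) * P.δ i) / π))) +
          Real.sqrt (∑' k : Fin 2 → ℤ, (if (Y : ℤ) ≤ |k 0| ∧ ((1 : ℕ) : ℤ) * |k 0| ≤ ((2 : ℕ) : ℤ) * |k 1| then (1 : ℝ) else 0) *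
            ‖mFourierCoeff (fun x => (a i x : ℂ)) k‖ ^ 2)) ^ 2 +
        ((1 + P.γ) ^ (2 * i) / ((Y * 2 ^ (7 * i + 20) : ℕ) : ℝ)) ^ 2 := by
  have hY1 : 1 ≤ Y := le_trans (by norm_num) hY
  have hYr : (50 : ℝ) ≤ Y := by exact_mod_cast hY
  have hYpos : (0 : ℝ) < Y := by linarith
  have hγ' : P.γ = ((8 : ℕ) : ℝ) := by rw [hγ]; norm_num
  have hd' : 0 < P.d := by rw [hd]; norm_num
  have hN₀' : 1 ≤ P.N₀ := by rw [hN₀]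
  have hρN' : 1 ≤ P.ρN := by rw [hρN]; norm_num
  have hNi : (P.N i : ℝ) = 2 ^ i := by rw [CascadeParams.N, hN₀, hρN]; push_cast; ring
  have h1 : 2 * 1 * 1 ≤ 1 * 2 := by norm_num
  have h2 : (Y - 1) * 1 ≤ 1 * Y := by omega
  have h3 : 1 * 10 * Y + 2 * 10 * 1 ≤ 19 * 1 * Y := by omega
  set η : ℝ := (ε / (159 * π * 8 * 2 ^ 20 * (Y : ℝ)) * (1 / 64) ^ i) with hη
  have hπ := Real.pi_pos
  have hηpos : 0 < η := by rw [hη]; positivity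
  have hstep := ratioClass_hstep_canonicalOsc_le P hγ' hδ₀ hd' hN₀' hρN' a b has h0 hb hab i (u := 1) (v := 6)
    (u' := 1) (v' := 2) (Y := Y) (qn := 19) (qd := 10) (Λ0 := Y) (by norm_num) (by norm_num) (by norm_num) (by norm_num)
    (by norm_num) hY1 le_rfl (fun m => max (2 * 1 * (Y * 2 ^ m) / 2) (Y - 1))
    (fun m => canonMax_Q₁_lt_Q₂ (by norm_num) (by norm_num) (by norm_num) h1 h2 h3 m)
    (fun m => canonMax_feed (by norm_num) (Y - 1) Y m) (rs := 10 / 3) (fun m => flatShallow_cutoff_le hY h2 m)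
    (7 * i + 20) hηpos hMδ
  -- the exact constants at `(u,v,q_n,q_d) = (1,6,19,10)`: `A* = 159`, `D₀ = Y/10`
  have eratio : ((((6 : ℕ) : ℝ) + ((1 : ℕ) : ℝ) * ((8 : ℕ) : ℝ)) * ((10 : ℕ) : ℝ) + ((1 : ℕ) : ℝ) * ((19 : ℕ) : ℝ)) /
      ((((1 : ℕ) : ℝ) * ((8 : ℕ) : ℝ) - ((6 : ℕ) : ℝ)) * ((10 : ℕ) : ℝ) - ((1 : ℕ) : ℝ) * ((19 : ℕ) : ℝ)) = 159 := by
    push_cast; norm_num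
  have eD : ((((1 : ℕ) : ℝ) * ((8 : ℕ) : ℝ) - ((6 : ℕ) : ℝ)) * ((10 : ℕ) : ℝ) - ((1 : ℕ) : ℝ) * ((19 : ℕ) : ℝ)) * (Y : ℝ) /
      (((1 : ℕ) : ℝ) * ((10 : ℕ) : ℝ)) = (Y : ℝ) / 10 := by
    push_cast; ring
  refine le_sq_sqrt_add_mono hstep ?_
  rw [eratio, eD, hNi]
  have hXe : (159 : ℝ) * π * ((8 : ℕ) : ℝ) * η * (Y : ℝ) / 2 ^ i * 2 ^ (7 * i + 20) = ε := by
    have e2 : (2 : ℝ) ^ (7 * i + 20) = 2 ^ 20 * 128 ^ i := by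
      rw [pow_add, pow_mul]; norm_num; ring
    have p1 : ((1 : ℝ) / 64) ^ i * (128 : ℝ) ^ i = (2 : ℝ) ^ i := by
      rw [← mul_pow]; norm_num
    have hne1 : (159 : ℝ) * Real.pi * 8 * 2 ^ 20 * (Y : ℝ) ≠ 0 := by positivity
    have hne2 : (2 : ℝ) ^ i ≠ 0 := pow_ne_zero _ two_ne_zero
    rw [hη, e2]
    push_cast
    calc (159 : ℝ) * π * 8 * (ε / (159 * π * 8 * 2 ^ 20 * (Y : ℝ)) * (1 / 64) ^ i) * (Y : ℝ) / 2 ^ i * (2 ^ 20 * 128 ^ i)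
        = ε * (((159 : ℝ) * Real.pi * 8 * 2 ^ 20 * (Y : ℝ)) / (159 * Real.pi * 8 * 2 ^ 20 * (Y : ℝ))) *
            ((((1 : ℝ) / 64) ^ i * 128 ^ i) / 2 ^ i) := by
          field_simp
      _ = ε := by rw [p1, div_self hne1, div_self hne2]; ring
  rw [hXe]

end Cascade

end Summit.AnomalousDissipation.AnomalousDissipation.Theorems.SawtoothPulseCascade.K1Window
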